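import Mathlib
import HarnessLib
import Summits.AtomisticToContinuum.HydrodynamicLimit.Theses.InformationPercolationEngine
import Literature.Probability.Entropy.StrongDataProcessingProofs
import Literature.Analysis.FluidPDE.LocalForecastCorrector

/-!
# Sketch — first lemmas of the crux idea `hidden-information-restart`
(crux `LocalSecondLaw`, stmt-AtomisticToContinuum-13081; crux-ideate round 2, ideator 4)

Nothing here is filed as an item. Part 1 is the abstract information-theoretic core of the lever
(PROVED, sorry-free): the hidden information of a law relative to a reference and a coarse map, the
data-processing inequality for the coarse relative entropy, and the RESTART inequality — the coarse
relative entropy (= coarse exergy = −coarse entropy + an affine functional of the conserved fields)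
after a reference-preserving step is at most the coarse relative entropy before PLUS the hidden
information before. Part 2 types the line's bet `HiddenInformationVanishes` over the crux's own
vocabulary (`localGibbsLaw`, `HardSphereFlow.flow`, `Torus.coarseCell`, `Config.restrictTo`,
Mathlib's `klDiv`): the time-integrated hidden information of a Lagrangian label group (the spheres
that start in one `r`-cell), relative to the group-alone canonical hard-sphere reference and the
group's own cell-wise conserved fields, is `o(n)` as `N → ∞` then `r → 0`, at EVERY horizon `τ`.
-/

noncomputable section

open MeasureTheory ProbabilityTheory InformationTheory Filter Set
open scoped ENNReal ProbabilityTheory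

namespace Summit.AtomisticToContinuum.HydrodynamicLimit.Cruxes.LocalSecondLaw.HiddenInformationRestart

/-! ## Part 1 — hidden information and the restart inequality (abstract; proved) -/

section Abstract

variable {X Y : Type*} [MeasurableSpace X] [MeasurableSpace Y]

/-- **Hidden information** of the law `μ` relative to the reference `π` and the coarse
(macrostate) map `M`: the fine relative entropy minus the coarse one. By the chain rule it is the
`μ`-average Kullback–Leibler divergence of the conditional laws given the macrostate, hence `≥ 0`
(`klDiv_map_le`): the information in `μ` that the macrostate does not show. -/
def hiddenInfo (μ π : Measure X) (M : X → Y) : ℝ≥0∞ :=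
  klDiv μ π - klDiv (μ.map M) (π.map M)

/-- Coarse relative entropy never exceeds fine relative entropy: data processing for the
deterministic kernel of the coarse map (the tree's `klDiv_comp_le`). -/
theorem klDiv_map_le [StandardBorelSpace X] [Nonempty X] (μ π : Measure X) [IsFiniteMeasure μ]
    [IsFiniteMeasure π] {M : X → Y} (hM : Measurable M) :
    klDiv (μ.map M) (π.map M) ≤ klDiv μ π := by
  have h := Literature.Probability.Entropy.klDiv_comp_le μ π (Kernel.deterministic M hM)
  rwa [Measure.deterministic_comp_eq_map, Measure.deterministic_comp_eq_map] at h

/-- Fine = coarse + hidden (whenever the fine relative entropy is finite the subtraction is honest). -/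
theorem klDiv_eq_map_add_hiddenInfo [StandardBorelSpace X] [Nonempty X] (μ π : Measure X)
    [IsFiniteMeasure μ] [IsFiniteMeasure π] {M : X → Y} (hM : Measurable M) :
    klDiv μ π = klDiv (μ.map M) (π.map M) + hiddenInfo μ π M := by
  unfold hiddenInfo
  exact (add_tsub_cancel_of_le (klDiv_map_le μ π hM)).symm

/-- **One reference-preserving step cannot raise the coarse relative entropy above the FINE one.**
If `T` preserves `π`, the coarse relative entropy of `T_# μ` is at most `klDiv μ π`. -/
theorem klDiv_map_map_le_of_map_eq [StandardBorelSpace X] [Nonempty X] (μ π : Measure X)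
    [IsFiniteMeasure μ] [IsFiniteMeasure π] {T : X → X} (hT : Measurable T) (hπ : π.map T = π)
    {M : X → Y} (hM : Measurable M) :
    klDiv ((μ.map T).map M) (π.map M) ≤ klDiv μ π := by
  have h1 : (μ.map T).map M = μ.map (M ∘ T) := Measure.map_map hM hT
  have h2 : π.map M = π.map (M ∘ T) := by rw [← Measure.map_map hM hT, hπ]
  rw [h1, h2]
  exact klDiv_map_le μ π (hM.comp hT)

/-- **RESTART INEQUALITY.** Under a reference-preserving step the coarse relative entropy (the
coarse EXERGY; minus the coarse entropy up to an affine functional of the conserved fields) grows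
by at most the hidden information present BEFORE the step. For a closed Liouville system this is
the whole content of "entropy can decrease between two positive times only by un-hiding
information"; at time `0` (local Gibbs data: hidden information `o(N)`) it is the free
Clausius inequality. -/
theorem restart [StandardBorelSpace X] [Nonempty X] (μ π : Measure X) [IsFiniteMeasure μ]
    [IsFiniteMeasure π] {T : X → X} (hT : Measurable T) (hπ : π.map T = π) {M : X → Y}
    (hM : Measurable M) :
    klDiv ((μ.map T).map M) (π.map M) ≤ klDiv (μ.map M) (π.map M) + hiddenInfo μ π M := by
  calc klDiv ((μ.map T).map M) (π.map M) ≤ klDiv μ π := klDiv_map_map_le_of_map_eq μ π hT hπ hM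
    _ = klDiv (μ.map M) (π.map M) + hiddenInfo μ π M := klDiv_eq_map_add_hiddenInfo μ π hM

/-- **Exact bookkeeping for a closed system**: coarse relative entropy after the step + hidden
information after = coarse before + hidden before (both equal the conserved fine relative entropy,
when `T` is a measurable EMBEDDING preserving `π`, e.g. the time-`t` map of a hard-sphere flow on
its good set). Entropy produced = information hidden. -/
theorem coarse_add_hidden_conserved [StandardBorelSpace X] [Nonempty X] (μ π : Measure X)
    [IsFiniteMeasure μ] [IsFiniteMeasure π] {T : X → X} (hT : MeasurableEmbedding T)
    (hπ : π.map T = π) {M : X → Y} (hM : Measurable M) :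
    klDiv ((μ.map T).map M) (π.map M) + hiddenInfo (μ.map T) π M =
      klDiv (μ.map M) (π.map M) + hiddenInfo μ π M := by
  rw [← klDiv_eq_map_add_hiddenInfo _ _ hM, ← klDiv_eq_map_add_hiddenInfo _ _ hM]
  conv_lhs => rw [← hπ]
  exact Literature.Probability.Entropy.klDiv_map_of_measurableEmbedding hT μ π

end Abstract

/-! ## Part 2 — the line's bet, typed over the crux vocabulary -/

open Literature.MathematicalPhysics.KineticTheory (T3 V3 hsDiameter localGibbsLaw)
open Literature.Analysis.FluidPDE (Config HardSphereFlow)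

/-- The GROUP-ALONE reference law: the canonical hard-sphere Gibbs law of `n` spheres of the SAME
diameter `ε_N = hsDiameter σ N` on `𝕋³`, unit activity and temperature, zero drift
(`canonicalDensity` of the homogeneous `localGibbsProfile` against the `n`-particle Liouville
measure). Its conditional law given the group's cell-wise conserved fields is uniform on the
hard-core shell (the Maxwellian weight is a function of the cell energies), so the hidden
information booked against it contains neither excluded-volume information nor any temperature /
drift mismatch (`hiddenInfo` depends on the reference only through its conditional laws given the
coarse map); what remains for a locally-Gibbs parcel is the within-cell Jensen gap `O(n r²)` and the
environment's cavity tilt on the boundary / self-diffusive mixing layer `O(n (ε_N + N^{-1/6}) / r)`. -/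
def groupRef (σ : ℝ) (N n : ℕ) : Measure (Config n (Fin 3) T3) :=
  (Literature.Analysis.FluidPDE.liouville (Literature.Analysis.FluidPDE.Torus.geometry (Fin 3)) n
      (hsDiameter σ N)).withDensity fun z =>
    ENNReal.ofReal
      (Literature.Analysis.FluidPDE.canonicalDensity (Literature.Analysis.FluidPDE.Torus.geometry (Fin 3))
        (hsDiameter σ N) n
        (Literature.MathematicalPhysics.KineticTheory.localGibbsProfile (fun _ => 1) (fun _ => 0)
          fun _ => 1)
        z)

/-- The GROUP's coarse map: cell-wise mass, momentum and kinetic energy of an `n`-particle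
configuration on the `r`-grid of `𝕋³` (`Torus.coarseCell`), normalised by `N + 1` like the
crux's empirical fields. Countably many cells, five numbers each. -/
def groupCoarse (N n : ℕ) (r : ℝ) (z : Config n (Fin 3) T3) : (Fin 3 → ℤ) → ℝ × V3 × ℝ :=
  fun c =>
    ( ((N : ℝ) + 1)⁻¹ * ∑ m : Fin n,
        (if Literature.Analysis.FluidPDE.Torus.coarseCell r (z m).1 = c then (1 : ℝ) else 0),
      ((N : ℝ) + 1)⁻¹ • ∑ m : Fin n,
        (if Literature.Analysis.FluidPDE.Torus.coarseCell r (z m).1 = c then (z m).2 else 0),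
      ((N : ℝ) + 1)⁻¹ * ∑ m : Fin n,
        (if Literature.Analysis.FluidPDE.Torus.coarseCell r (z m).1 = c then ‖(z m).2‖ ^ 2 / 2
          else 0) )

/-- **`HiddenInformationVanishes` (the bet of the line `hidden-information-restart`; ALL horizons
`τ`, no Euler solution, no `τ < T`).** For continuous positive profiles there is `σ₀` such that for
`σ < σ₀`, every flow family, every horizon `τ` and tolerance `η`, for `r < r₀(η)` and
`N ≥ N₀(r)`: for every `r`-cell `c` and group size `n ≥ η (N+1) r³`, conditioning the local Gibbs
law on "the spheres labelled `< n` are exactly those starting in cell `c`" (exchangeability makes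
this the Lagrangian parcel of cell `c`), the law at time `s` of that LABEL GROUP (push the
conditioned law through `Φ_s`, restrict to the group's labels) has hidden information — relative to
the group-alone hard-sphere reference `groupRef` and to the group's OWN cell-wise conserved fields
(i.e. the Shannon deficit to its own hard-core microcanonical shell) — whose time integral
over `[0, τ]` is at most `η τ n`: produced entropy does not stay stored, un-diluted, inside a small
parcel. Pre-shock it follows from `RelEntropyVanishing` (stmt-0766, parcel-averaged form); it is
the quantity that survives post-shock, where the global specific relative entropy is `Θ(1)`. -/
def HiddenInformationVanishes : Prop :=
  ∀ (a₀ θ₀ : T3 → ℝ) (u₀ : T3 → V3), Continuous a₀ → Continuous θ₀ → Continuous u₀ →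
    (∀ x, 0 < a₀ x) → (∀ x, 0 < θ₀ x) →
  ∃ σ₀ : ℝ, 0 < σ₀ ∧ ∀ σ : ℝ, 0 < σ → σ < σ₀ →
  ∀ Φ : (N : ℕ) → HardSphereFlow (Literature.Analysis.FluidPDE.Torus.geometry (Fin 3))
      (hsDiameter σ N) (N + 1),
  ∀ τ : ℝ, 0 < τ → ∀ η : ℝ, 0 < η →
  ∃ r₀ : ℝ, 0 < r₀ ∧ ∀ r : ℝ, 0 < r → r < r₀ → ∃ N₀ : ℕ, ∀ N : ℕ, N₀ ≤ N →
  ∀ (c : Fin 3 → ℤ) (n : ℕ), n ≤ N + 1 → η * (((N : ℝ) + 1) * r ^ 3) ≤ n →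
    let μ := localGibbsLaw σ a₀ u₀ θ₀ N (Φ N)
    let S : Finset (Fin (N + 1)) := Finset.univ.filter fun i => i.val < n
    let E : Set (Config (N + 1) (Fin 3) T3) :=
      {z | ∀ i : Fin (N + 1),
        (i.val < n ↔ Literature.Analysis.FluidPDE.Torus.coarseCell r (z i).1 = c)}
    let μE := ProbabilityTheory.cond μ E
    let lawA : ℝ → Measure (Config S.card (Fin 3) T3) := fun s =>
      (μE.map ((Φ N).flow s)).map (Literature.Analysis.FluidPDE.Config.restrictTo S)
    let π : Measure (Config S.card (Fin 3) T3) := groupRef σ N S.card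
    (∫⁻ s in Set.Icc (0 : ℝ) τ, hiddenInfo (lawA s) π (groupCoarse N S.card r)) ≤
      ENNReal.ofReal (η * τ * n)

end Summit.AtomisticToContinuum.HydrodynamicLimit.Cruxes.LocalSecondLaw.HiddenInformationRestart
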